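import Summits.ResolutionOfSingularities.ResolutionOfSingularities.Theorems.WeightedInvariantTieFinitePointwise
import HarnessLib

/-!
# Finiteness of the tie points — height bookkeeping for the scheme step: primes strictly above the height-two prime of the curve are
# maximal in a threefold ring, and a curve of order `≤ 1` carries no tie point (door `HypersurfaceCentreConstruction`,
# stmt-ResolutionOfSingularities-19897, route `WeightedInvariant`, P3 rung `KeyRungGrLE 3 p`, clause (c8)≤3,p for the letter `τ`)

[OURS · L1 W4.3 · cell `res-hironaka`, HUMAN RULING D-0089] Helper file `--supports stmt-ResolutionOfSingularities-19897` (line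
`local-engine` of res-L1-w43-plan-1, spec `L/res-type-047/D2-INCHART-SPEC-v3.md` steps (S0)/(S2)).
* `TieFinite.isMaximal_of_lt_of_height` — in a ring all of whose primes have height `≤ 3`, every prime strictly above a prime of height
  `≥ 2` is maximal: the binder `hmax` of `TieFinite.finite_tiePrimes` (p548769) on an affine chart of a threefold (`dim 𝒪_y ≤ 3`).
* `TieFinite.IsTiePosition.two_le_of_iotaOrd_eq` — `IsTiePosition S g ∧ iotaOrd S g = n ⇒ 2 ≤ n` (the `iotaOrd` currency of
  `IsTiePosition.two_le_order`, p549040): step (S0), a curve of order `n ≤ 1` has no tie point in its fibre.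

[OURS] Replaces the role of NO printed item; NOT a statement of the manuscript under review [claim: Hironaka2017, status:
under-review].  AI work, weaker than expert review.  Def-free.

## References

* H. Matsumura, *Commutative Ring Theory*, §5 (height), Thm. 13.5. [Matsumura1987]
-/

noncomputable section

set_option linter.dupNamespace false -- mandated namespace `Summit.<Summit>.<Problem>` of this single-conjunct summit

open IsLocalRing Literature.AlgebraicGeometry.Resolution
open Summit.ResolutionOfSingularities.ResolutionOfSingularities.Theorems

namespace Summit.ResolutionOfSingularities.ResolutionOfSingularities.Cruxes.HypersurfaceCentreConstruction.LocalEngine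

namespace TieFinite

/-- **Primes strictly above a height-`≥ 2` prime are maximal when all heights are `≤ 3`.** [cite: Matsumura1987, §5] -/
theorem isMaximal_of_lt_of_height {A : Type} [CommRing A] (hbound : ∀ (𝔭 : Ideal A) [𝔭.IsPrime], 𝔭.height ≤ 3)
    {P : Ideal A} [P.IsPrime] (hP : 2 ≤ P.height) (𝔮 : Ideal A) (h𝔮 : 𝔮.IsPrime) (hlt : P < 𝔮) : 𝔮.IsMaximal := by
  haveI := h𝔮
  have h𝔮3 : 3 ≤ 𝔮.height := by
    have h := Ideal.height_add_one_le_of_lt_of_isPrime hlt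
    calc (3 : ℕ∞) = 2 + 1 := by norm_num
      _ ≤ P.height + 1 := add_le_add_left hP 1
      _ ≤ 𝔮.height := h
  obtain ⟨M, hM, h𝔮M⟩ := Ideal.exists_le_maximal 𝔮 h𝔮.ne_top
  rcases eq_or_lt_of_le h𝔮M with h | h
  · exact h ▸ hM
  · exfalso
    haveI := hM.isPrime
    have hM4 : (4 : ℕ∞) ≤ M.height :=
      calc (4 : ℕ∞) = 3 + 1 := by norm_num
        _ ≤ 𝔮.height + 1 := add_le_add_left h𝔮3 1
        _ ≤ M.height := Ideal.height_add_one_le_of_lt_of_isPrime h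
    have h43 : (4 : ℕ∞) ≤ 3 := hM4.trans (hbound M)
    exact absurd h43 (by decide)

/-- **A tie position has `iotaOrd ≥ 2`**: `IsTiePosition S g`, `iotaOrd S g = n` ⇒ `2 ≤ n`. [cite: Matsumura1987, Thm. 13.5] -/
theorem IsTiePosition.two_le_of_iotaOrd_eq {S : Type} [CommRing S] {g : S} (hz : Iota3.IsTiePosition S g) {n : ℕ}
    (hn : iotaOrd S g = n) : 2 ≤ n := by
  haveI := hz.1
  obtain ⟨h1, h2⟩ := (iotaOrd_eq_natCast_iff S g n).mp hn
  exact IsTiePosition.two_le_order hz h1 h2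

end TieFinite

end Summit.ResolutionOfSingularities.ResolutionOfSingularities.Cruxes.HypersurfaceCentreConstruction.LocalEngine

end
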